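import Summits.ResolutionOfSingularities.ResolutionOfSingularities.Theorems.FrobeniusLadderFInjectiveMacaulayficationSpecimenDoor
import Summits.ResolutionOfSingularities.ResolutionOfSingularities.Theorems.FrobeniusLadderFInjectiveMacaulayficationT4PlusCM
import Summits.ResolutionOfSingularities.ResolutionOfSingularities.Theorems.FrobeniusLadderFInjectiveMacaulayficationT4PlusOffStratum
import Summits.ResolutionOfSingularities.ResolutionOfSingularities.Theorems.FrobeniusLadderFInjectiveMacaulayficationT4PlusPrime
import HarnessLib

/-!
# THE SPECIMEN DOOR FOR `T⁽⁴⁾⁺`: the crux statement for `V(Φ−y²−x³, z²+Φ³+w⁷+v⁸+x¹²) ⊂ 𝔸⁶` in characteristic `7`,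
# conditional only on point-fixability at the origin (crux `FInjectiveMacaulayfication`, R12.24 (b))

Support file for crux stmt-ResolutionOfSingularities-15315 (`FrobeniusLadder.FInjectiveMacaulayfication`), chain w45a,
seat res-L1-w45a-stub-4 (res-L1-w45a-plan-1 R12.24 (b); the `T⁽⁴⁾⁺` twin of stub-3's `T11SpecimenDoor`, typed against stub-3's
GENERIC door `SpecimenDoor.fInjectiveMacaulayfication_of_originPointFixable`, binder list 09:32:10Z). [OURS · L1 W4.5a] — NOT a
statement of the manuscript [claim: Hironaka2017]; AI-written, weaker than expert review.

`X = Spec k[x,y,z,w,v,Φ]/(Fs)`, `Fs 0 = Φ − y² − x³`, `Fs 1 = z² + Φ³ + w⁷ + v⁸ + x¹²` (stub-6's `T4PlusPrime` convention,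
`(x,y,z,w,v,Φ) = (X 0, …, X 5)`), `char k = 7` — idea-1's key re-embedding of the DECIDING SPECIMEN `T⁽⁴⁾` of kill test K-T4 /
K4.5. MAIN THEOREM `fInjectiveMacaulayfication_T4plus_char7`: **if the local ring of `X` at the origin is point-fixable (`h0`, the
`PFix` text of A-loc `OfPointFixable.fInjectiveMacaulayfication_of_pointFixable`), then `X` has a proper birational model all of
whose stalks are domains, Cohen–Macaulay and F-injective** (the crux's conclusion for this `X`). The four specimen inputs of the
generic door are tree theorems: `hprime` = `T4PlusPrime.t4plus_prime_and_X_ne_zero` (stub-6), `h𝔪` = `T4PlusCM.isMaximal_origin`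
(U7 `QuotientOriginMaximal`, res-D-pv-040), `hoff` = `T4PlusOffStratum.t4Plus_clause_off_origin` (THE ONLY POSSIBLY BAD CLOSED POINT
IS THE ORIGIN: Jacobian minors + Fedder at the F-pure singular circle `x³ = 1`), `hCM` = `T4PlusCM.cm_at_maximal` (c.i. of the
expected dimension). `h0` is what road B (`PointFixableOfCert.pointFixable_of_ciCert` on tri-1's 537-chart toric certificate at
`p = 7`, transported from the hypersurface model by stub-2's I11) discharges.

* `fInjectiveMacaulayfication_T4plus_char7` — the door instance.

No definitions, no named facts; a 1-step composition. [folklore]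
-/

-- single-problem summit: the doubled namespace component is forced
set_option linter.dupNamespace false

noncomputable section

namespace Summit.ResolutionOfSingularities.ResolutionOfSingularities.Theorems.FInjectiveMacaulayfication.T4SpecimenDoor

open MvPolynomial AlgebraicGeometry
open Summit.ResolutionOfSingularities.ResolutionOfSingularities.Theorems.FInjectiveMacaulayfication

/-- **THE CRUX STATEMENT FOR `T⁽⁴⁾⁺` AT `p = 7`, MODULO POINT-FIXABILITY AT THE ORIGIN.** For
`X = Spec k[x,y,z,w,v,Φ]/(Φ − y² − x³, z² + Φ³ + w⁷ + v⁸ + x¹²)`, `char k = 7`: if the local ring at the origin is point-fixable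
(`h0`: some `𝔪`-primary `(c₁,…,c_m) ≠ 0` whose blow-up algebras satisfy the domain + Cohen–Macaulay + F-injective clause at every
prime over `𝔪`), then there are a scheme `X'` and a proper birational `π : X' ⟶ X` such that every stalk of `X'` is a domain in
which every system of parameters is weakly regular and generates a Frobenius-closed ideal. (Generic door
`SpecimenDoor.fInjectiveMacaulayfication_of_originPointFixable` ∘ `T4PlusPrime` ∘ `T4PlusCM` ∘ `T4PlusOffStratum.t4Plus_clause_off_origin`.)
[folklore] -/
theorem fInjectiveMacaulayfication_T4plus_char7 (k : Type) [Field k] [CharP k 7] (Fs : Fin 2 → MvPolynomial (Fin 6) k)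
    (hF₀ : Fs 0 = X 5 - X 1 ^ 2 - X 0 ^ 3) (hF₁ : Fs 1 = X 2 ^ 2 + X 5 ^ 3 + X 3 ^ 7 + X 4 ^ 8 + X 0 ^ 12)
    (h0 : ∀ b : Spec (.of (MvPolynomial (Fin 6) k ⧸ Ideal.span (Set.range Fs))),
      b.asIdeal = Ideal.span (Set.range fun j : Fin 6 => Ideal.Quotient.mk (Ideal.span (Set.range Fs)) (X j)) →
      ∃ (m : ℕ) (c : Fin m → (Spec (.of (MvPolynomial (Fin 6) k ⧸ Ideal.span (Set.range Fs)))).presheaf.stalk b),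
        Ideal.span (Set.range c) ≠ ⊥ ∧
        (Ideal.span (Set.range c)).radical =
          IsLocalRing.maximalIdeal ((Spec (.of (MvPolynomial (Fin 6) k ⧸ Ideal.span (Set.range Fs)))).presheaf.stalk b) ∧
        ∀ (j : Fin m) (𝔔 : PrimeSpectrum (Literature.AlgebraicGeometry.Resolution.blowupAlgebra (Ideal.span (Set.range c)) (c j))),
          𝔔.asIdeal.comap (algebraMap ((Spec (.of (MvPolynomial (Fin 6) k ⧸ Ideal.span (Set.range Fs)))).presheaf.stalk b)
            (Literature.AlgebraicGeometry.Resolution.blowupAlgebra (Ideal.span (Set.range c)) (c j))) =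
            IsLocalRing.maximalIdeal ((Spec (.of (MvPolynomial (Fin 6) k ⧸ Ideal.span (Set.range Fs)))).presheaf.stalk b) →
          IsDomain (Localization.AtPrime 𝔔.asIdeal) ∧ ∀ d : ℕ, ringKrullDim (Localization.AtPrime 𝔔.asIdeal) = d →
            ∀ s : Fin d → Localization.AtPrime 𝔔.asIdeal, (Ideal.span (Set.range s)).radical.IsMaximal →
              RingTheory.Sequence.IsWeaklyRegular (Localization.AtPrime 𝔔.asIdeal) (List.ofFn s) ∧
              ∀ y : Localization.AtPrime 𝔔.asIdeal, (∃ e : ℕ, y ^ 7 ^ e ∈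
                Ideal.span ((fun z : Localization.AtPrime 𝔔.asIdeal => z ^ 7 ^ e) ''
                  (Ideal.span (Set.range s) : Set (Localization.AtPrime 𝔔.asIdeal)))) → y ∈ Ideal.span (Set.range s)) :
    ∃ (X' : Scheme.{0}) (π : X' ⟶ (Spec (.of (MvPolynomial (Fin 6) k ⧸ Ideal.span (Set.range Fs))))), IsProper π ∧
      Literature.AlgebraicGeometry.Resolution.IsBirational π ∧
      ∀ x : X', IsDomain (X'.presheaf.stalk x) ∧ ∀ d : ℕ, ringKrullDim (X'.presheaf.stalk x) = d →
        ∀ s : Fin d → X'.presheaf.stalk x, (Ideal.span (Set.range s)).radical.IsMaximal →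
          RingTheory.Sequence.IsWeaklyRegular (X'.presheaf.stalk x) (List.ofFn s) ∧
          ∀ y : X'.presheaf.stalk x, (∃ e : ℕ, y ^ 7 ^ e ∈
            Ideal.span ((fun z : X'.presheaf.stalk x => z ^ 7 ^ e) '' (Ideal.span (Set.range s) : Set (X'.presheaf.stalk x)))) →
            y ∈ Ideal.span (Set.range s) := by
  obtain ⟨hprime, -⟩ := T4PlusPrime.t4plus_prime_and_X_ne_zero k Fs hF₀ hF₁
  exact SpecimenDoor.fInjectiveMacaulayfication_of_originPointFixable 7 (by norm_num) k 6 2 Fs hprime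
    (T4PlusCM.isMaximal_origin Fs hF₀ hF₁) (T4PlusOffStratum.t4Plus_clause_off_origin k Fs hF₀ hF₁)
    (T4PlusCM.cm_at_maximal Fs hF₀ hF₁) h0

end Summit.ResolutionOfSingularities.ResolutionOfSingularities.Theorems.FInjectiveMacaulayfication.T4SpecimenDoor

end
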